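import Literature.Probability.Percolation.BondLocallyMonotoneFKG
import Literature.Probability.Percolation.AnnulusCrossingBoundProofs
import Literature.Probability.Percolation.NewmanSchulman
import Literature.Probability.Percolation.CrossingChains
import Literature.Probability.Percolation.LatticeSymmetry
import Literature.Probability.Percolation.FourArmGarbanDocking
import HarnessLib

/-!
# Crux `StripClusterRates` (stmt-CriticalPhenomena-13878), line two-cluster-rate-is-stationary-gap, reshape 5 (lead c6):
generic locality tools for the generalised-FKG step (`cg_glue_nolin`)

Support file (`--supports stmt-CriticalPhenomena-13878`): pairs of sites versus dual pairs (`nl_dualEdge_notMem_sym2`: a dual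
pair of faces `A` is never a pair of sites of a disjoint `B`), locality and monotonicity of translated events
(`(relabel (shift (-u)))⁻¹' E`) and of dual events (`dualConfig ⁻¹' E`).
-/

noncomputable section

open MeasureTheory Filter Topology Set
open Literature.Probability.LatticeModels Literature.Probability.Percolation

namespace Summit.CriticalPhenomena.CardyFormulaZ2.Cruxes.StripClusterRates.TwoClusterRateIsStationaryGap

/-! ## §0 Generic tools: pairs of sites, duality, translation -/

/-- **Dual pairs of `A` are never pairs of a disjoint `B`.** If `dualEdge e` is a pair of sites (faces) of `A` and `A`, `B` are
disjoint sets of sites, then `e` is not a pair of sites of `B`: for a lattice edge `e = {u, u+eᵢ}` the face `u` is an endpoint of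
`dualEdge e`, and off the edge set `dualEdge` is the identity. [folklore] -/
theorem nl_dualEdge_notMem_sym2 {A B : Finset (Site 2)} (h : Disjoint A B) {e : Sym2 (Site 2)}
    (he : dualEdge e ∈ A.sym2) : e ∉ B.sym2 := by
  intro heB
  by_cases hE : e ∈ (zdGraph 2).edgeSet
  · obtain ⟨u, i, rfl⟩ := mem_edgeSet_zdGraph_iff.1 hE
    have huB : u ∈ B := Finset.mem_sym2_iff.1 heB u (Sym2.mem_mk_left _ _)
    have huA : u ∈ A := by
      fin_cases i
      · simp only [Fin.zero_eta, Fin.isValue] at he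
        rw [dualEdge_horizontal] at he
        exact Finset.mem_sym2_iff.1 he u (Sym2.mem_mk_right _ _)
      · simp only [Fin.mk_one, Fin.isValue] at he
        rw [dualEdge_vertical] at he
        exact Finset.mem_sym2_iff.1 he u (Sym2.mem_mk_right _ _)
    exact Finset.disjoint_left.1 h huA huB
  · rw [dualEdge_of_not_mem hE] at he
    induction e using Sym2.ind with
    | h x y =>
      exact Finset.disjoint_left.1 h (Finset.mem_sym2_iff.1 he x (Sym2.mem_mk_left _ _))
        (Finset.mem_sym2_iff.1 heB x (Sym2.mem_mk_left _ _))

/-- The pairs read by a dual event on the faces `A` avoid the pairs of any set of sites disjoint from `A`. [folklore] -/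
theorem nl_disjoint_preimage_dualEdge {A B : Finset (Site 2)} (h : Disjoint A B) :
    Disjoint (A.sym2.preimage dualEdge dualEdge_bijective.injective.injOn) B.sym2 := by
  rw [Finset.disjoint_left]
  intro e he
  rw [Finset.mem_preimage] at he
  exact nl_dualEdge_notMem_sym2 h he

/-- Pairs of sites of disjoint sets of sites are disjoint. [folklore] -/
theorem nl_disjoint_sym2 {A B : Finset (Site 2)} (h : Disjoint A B) : Disjoint A.sym2 B.sym2 := by
  rw [Finset.disjoint_left]
  intro e heA heB
  induction e using Sym2.ind with
  | h x y =>
    exact Finset.disjoint_left.1 h (Finset.mem_sym2_iff.1 heA x (Sym2.mem_mk_left _ _))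
      (Finset.mem_sym2_iff.1 heB x (Sym2.mem_mk_left _ _))

/-- The translate by `-u` of the pairs of `K` are the pairs of `K + u`… read backwards: the inverse image set that
`DeterminedBy.preimage_relabel` produces for the shift `-u` consists of pairs of sites of `K.image (· + u)`. [folklore] -/
theorem nl_symm_image_sym2_subset (u : Site 2) (K : Finset (Site 2)) :
    (sym2Equiv (Site.shift (-u))).symm '' (↑K.sym2 : Set (Sym2 (Site 2))) ⊆ ↑(K.image (· + u)).sym2 := by
  rintro z ⟨w, hw, rfl⟩
  rw [Finset.mem_coe] at hw ⊢
  rw [sym2Equiv_symm, sym2Equiv_apply]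
  rw [Finset.mem_sym2_iff] at hw ⊢
  intro a ha
  rw [Sym2.mem_map] at ha
  obtain ⟨c, hc, rfl⟩ := ha
  refine Finset.mem_image.2 ⟨c, hw c hc, ?_⟩
  rw [Site.shift_symm_apply, sub_neg_eq_add]

/-- **Locality of a translated event**: if `E` is determined by the pairs of `K`, then `E` translated by `+u`
(`(relabel (shift (-u)))⁻¹' E`) is determined by the pairs of `K + u`. [folklore] -/
theorem nl_determinedBy_pre {E : Set (BondConfig (Site 2))} {K : Finset (Site 2)} (hE : DeterminedBy E ↑K.sym2)
    (u : Site 2) :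
    DeterminedBy ((BondConfig.relabel (sym2Equiv (Site.shift (-u)))) ⁻¹' E) ↑(K.image (· + u)).sym2 :=
  (hE.preimage_relabel _).mono (nl_symm_image_sym2_subset u K)

/-- A translated increasing event is increasing. [folklore] -/
theorem nl_isUpperSet_pre {E : Set (BondConfig (Site 2))} (hE : IsUpperSet E) (u : Site 2) :
    IsUpperSet ((BondConfig.relabel (sym2Equiv (Site.shift (-u)))) ⁻¹' E) :=
  fun _ _ hle h => hE (BondConfig.relabel_mono _ hle) h

/-- A translated decreasing event is decreasing. [folklore] -/
theorem nl_isLowerSet_pre {E : Set (BondConfig (Site 2))} (hE : IsLowerSet E) (u : Site 2) :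
    IsLowerSet ((BondConfig.relabel (sym2Equiv (Site.shift (-u)))) ⁻¹' E) :=
  fun _ _ hle h => hE (BondConfig.relabel_mono _ hle) h

/-- The dual preimage of an increasing event is decreasing. [folklore] -/
theorem nl_isLowerSet_dual {E : Set (BondConfig (Site 2))} (hE : IsUpperSet E) : IsLowerSet (dualConfig ⁻¹' E) :=
  fun _ _ hle h => hE (dualConfig_antitone hle) h

/-- **Locality of a dual event**: if `E` is determined by the pairs of the faces `A`, then `dualConfig ⁻¹' E` is determined by
the `dualEdge`-preimage of those pairs. [folklore] -/
theorem nl_determinedBy_dual {E : Set (BondConfig (Site 2))} {A : Finset (Site 2)} (hE : DeterminedBy E ↑A.sym2) :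
    DeterminedBy (dualConfig ⁻¹' E) ↑(A.sym2.preimage dualEdge dualEdge_bijective.injective.injOn) := by
  rw [Finset.coe_preimage]
  exact hE.preimage_dualConfig

/-- An open crossing event of a finite set of sites `S ⊆ T` is determined by the pairs of `T`. [folklore] -/
theorem nl_determinedBy_openCrossing {S T : Finset (Site 2)} (h : S ⊆ T) (A B : Set (Site 2)) :
    DeterminedBy (openCrossing (↑S : Set (Site 2)) A B) ↑T.sym2 :=
  (PlanarDuality.determinedBy_openCrossing S A B).mono (Finset.coe_subset.2 (Finset.sym2_mono h))



end Summit.CriticalPhenomena.CardyFormulaZ2.Cruxes.StripClusterRates.TwoClusterRateIsStationaryGap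

end
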